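import Literature.NumberTheory.Rogawski1990.AdelicStableOrbitalSumFactor
import HarnessLib

/-!
# The adelic classes `𝒞_𝐀(γ₀)` as a restricted product and `Σ_{𝒞_𝐀(γ₀)} Φ = Φ^st_∞ · ∏_v Φ^st_v`, from the `K_v`-CONJUGACY CLAUSE AT ONE PAIR `(γ₀, γ)`
# — the E-chain (E2)∕(E3a) WITHOUT the regularity of `γ₀` (singular ∕ semisimple classes: row O7, K6-δ)
(Rogawski, *Automorphic Representations of Unitary Groups in Three Variables* (1990), §3.3 p. 21, §4.3 p. 44, §5.4 (5.4.3) pp. 72–73; Kottwitz,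
*Stable trace formula: elliptic singular terms* (1986), Prop. 7.1)

Topic `NumberTheory/Rogawski1990`; namespace `Literature.NumberTheory.Rogawski1990`.  THEOREMS ONLY: no definition, no named fact, no instance, no notation,
no `sorry`.  Cell `pub/hodgecm-mathlib`, ENGINE T1 (crux H413 = `stmt-HodgeConjecture-24833`), row O7 «singular semisimple stable classes», piece **K6-δ**
(O7 OWNER WORD #3 (3), RULING #109 (2)), file 1 of 2.

THE POINT.  The ★ E-chain — (E2) `MatchingAdeleG.eventually_map_toLocal_eq_mk` ∕ `eq_of_forall_map_toLocal_eq_of_map_archPart_eq` (the dictionary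
«classes of `𝒞_𝐀(γ₀)` ↔ admissible families of local classes + an archimedean class»), (E3a) `MatchingAdeleG.adelicStableOrbitalSum_eq_finsum_mul_prod_finsum{,_of_finset}`
and `MatchingAdeleG.isEulerOnClasses_of_factor` — is typed for a REGULAR `γ₀ ∈ U(H)(L⁺)` because it consumes Kottwitz's Prop. 7.1 through the NAMED FACT
★ `MatchingAdeleGEventuallyKConj L H`, whose `∀` ranges over regular pairs.  Every one of those proofs uses the fact ONLY as its body at the one pair
`(γ₀, γ)` (`hKC γ₀ γ hreg hγ`, `hKC.eventually_forall_exists_conj hreg hγ`).  This file re-proves the chain with that body as an explicit hypothesis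

  `hKCγ : ∀ᶠ v in cofinite, ∀ g ∈ K_v, (γ₀)_v ↔ g → ∃ k ∈ K_v, k γ_v k⁻¹ = g`      («(KC) at the pair», [Rogawski1990, §3.3 p. 21])

for ANY rational `γ₀` with a rational correspondent `γ ∈ U(Φ₃)(L⁺)` — no regularity, no semisimplicity predicate inside the statements (they enter only
where the clause is DISCHARGED: ★ `MatchingAdeleGKConjHolds` at regular `γ₀`, the O7 rows K6-α at singular semisimple `γ₀`).  The proofs are the ★ ones
token for token with the one substitution; the ★ regular theorems are the specialisations `hKCγ := hKC γ₀ γ hreg hγ`.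

* §0 `MatchingAdeleG.eventually_forall_exists_conj_of_eventuallyKConj` (the clause read on matching adèles) and the two readings of the clause against
  the `GL_3`-conjugacy form at `γ` used by ★ K6-β `UnramifiedOrbitalUnitFactorSemisimple` (`…_of_isConj_toLocal`, `…isConj_toLocal_of…`).
* §1 (E2, pair-level) `MatchingAdeleG.eventually_map_toLocal_eq_mk_of_eventuallyKConj` (ev), `MatchingAdeleG.eq_of_forall_map_toLocal_eq_of_map_archPart_eq_of_eventuallyKConj` (inj).
* §2 (E3a, pair-level) `MatchingAdeleG.adelicStableOrbitalSum_eq_finsum_mul_prod_finsum_of_eventuallyKConj`, `…_of_finset_of_eventuallyKConj`.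
File 2 (`AdelicStableOrbitalEulerDischargeOfKConj`) carries (E3a §2) `MatchingAdeleG.isEulerOnClasses_of_factor_of_eventuallyKConj` and the (xii-d)-type discharge
`MatchingAdeleG.exists_isEulerOnClasses_ofLocalAdelic_of_eventuallyKConj`.
HC_CM is proved only modulo the printed citations until rung 0 closes; this file is unconditional (the clause is a hypothesis, nothing printed is consumed).

## References
* [Rogawski1990] J. D. Rogawski, *Automorphic Representations of Unitary Groups in Three Variables*, Ann. of Math. Stud. 123 (1990), §3.3 p. 21, §4.1
  (4.1.1) p. 39, §4.3 p. 44, §5.4 (5.4.3) pp. 72–73.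
* [Kottwitz1986] R. E. Kottwitz, *Stable trace formula: elliptic singular terms*, Math. Ann. 275 (1986), Prop. 7.1, §7.3.
* [BorelJacquet1979] A. Borel, H. Jacquet, *Automorphic forms and automorphic representations*, PSPM 33.1 (1979), §4.1.
-/

set_option autoImplicit false

noncomputable section

open NumberField IsDedekindDomain Filter Function
open scoped MatrixGroups

namespace Literature.NumberTheory.Rogawski1990

open Literature.NumberTheory.Automorphic Literature.Topology.Algebra.RestrictedProduct

/-! ## §0 The clause at the pair, read on matching adèles and against the `GL_3`-conjugacy form at `γ` -/

section Clause

variable {L : Type} [Field L] [NumberField L] [IsCMField L] {H : Matrix (Fin 3) (Fin 3) L}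
  {γ₀ : (UnitaryGroup.cmDatum L 3 H).Rational}
  {γ : (UnitaryGroup.cmDatum L 3 (Matrix.of fun i j : Fin 3 => if i.val + j.val + 1 = 3 then (1 : L) else 0)).Rational}

/-- **The clause read on matching adèles** (pair-level form of ★ `MatchingAdeleGEventuallyKConj.eventually_forall_exists_conj`): a.e. `v`, every matching
adèle over `γ₀` whose `v`-component lies in `K_v` has that component `K_v`-conjugate to `γ_v` (a matching adèle's component corresponds to `(γ₀)_v`,
★ `MatchingAdeleG.corresponds_toLocal`). [cite: Rogawski1990, §3.3 p. 21] [cite: Kottwitz1986, Prop. 7.1] -/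
theorem MatchingAdeleG.eventually_forall_exists_conj_of_eventuallyKConj
    (hKCγ : ∀ᶠ v in cofinite, ∀ g : (UnitaryGroup.cmDatum L 3 (Matrix.of fun i j : Fin 3 => if i.val + j.val + 1 = 3 then (1 : L) else 0)).Local v,
      g ∈ UnitaryGroup.cmLocalIntegralLevel L 3 (Matrix.of fun i j : Fin 3 => if i.val + j.val + 1 = 3 then (1 : L) else 0) v →
        Corresponds (UnitaryGroup.conjLocal L (IsCMField.complexConj L) v)
            ((UnitaryGroup.adelicForm L 3 H).map (UnitaryGroup.adeleToLocal L v))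
            ((UnitaryGroup.adelicForm L 3 (Matrix.of fun i j : Fin 3 => if i.val + j.val + 1 = 3 then (1 : L) else 0)).map (UnitaryGroup.adeleToLocal L v))
            ((UnitaryGroup.cmDatum L 3 H).toLocal v ((UnitaryGroup.cmDatum L 3 H).toAdelic γ₀)) g →
          ∃ k ∈ UnitaryGroup.cmLocalIntegralLevel L 3 (Matrix.of fun i j : Fin 3 => if i.val + j.val + 1 = 3 then (1 : L) else 0) v,
            k * (UnitaryGroup.cmDatum L 3 (Matrix.of fun i j : Fin 3 => if i.val + j.val + 1 = 3 then (1 : L) else 0)).toLocal v ((UnitaryGroup.cmDatum L 3 (Matrix.of fun i j : Fin 3 => if i.val + j.val + 1 = 3 then (1 : L) else 0)).toAdelic γ) * k⁻¹ = g) :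
    ∀ᶠ v in cofinite, ∀ p : MatchingAdeleG L H γ₀,
      (UnitaryGroup.cmDatum L 3 (Matrix.of fun i j : Fin 3 => if i.val + j.val + 1 = 3 then (1 : L) else 0)).toLocal v p.adele ∈
          UnitaryGroup.cmLocalIntegralLevel L 3 (Matrix.of fun i j : Fin 3 => if i.val + j.val + 1 = 3 then (1 : L) else 0) v →
        ∃ k ∈ UnitaryGroup.cmLocalIntegralLevel L 3 (Matrix.of fun i j : Fin 3 => if i.val + j.val + 1 = 3 then (1 : L) else 0) v,
          k * (UnitaryGroup.cmDatum L 3 (Matrix.of fun i j : Fin 3 => if i.val + j.val + 1 = 3 then (1 : L) else 0)).toLocal v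
                ((UnitaryGroup.cmDatum L 3 (Matrix.of fun i j : Fin 3 => if i.val + j.val + 1 = 3 then (1 : L) else 0)).toAdelic γ) *
              k⁻¹ =
            (UnitaryGroup.cmDatum L 3 (Matrix.of fun i j : Fin 3 => if i.val + j.val + 1 = 3 then (1 : L) else 0)).toLocal v p.adele := by
  filter_upwards [hKCγ] with v hv p hint
  exact hv _ hint (p.corresponds_toLocal v)

/-- **The clause from its `GL_3`-conjugacy form at `γ`** (the (KC) binder of ★ K6-β `UnramifiedOrbitalUnitFactorSemisimple`, O7 OWNER WORD #1 (A)): since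
`(γ₀)_v ↔ γ_v` (★ `corresponds_toLocal_toAdelic`), «`g ∼_{GL} γ_v`» and «`(γ₀)_v ↔ g`» are the same condition on `g ∈ U(Φ₃)(L⁺_v)`.
[cite: Rogawski1990, §3.3 p. 21; §14.1 p. 232] -/
theorem MatchingAdeleG.eventuallyKConj_of_isConj_toLocal
    (hγ : Corresponds (cmConjRingHom L) H (Matrix.of fun i j : Fin 3 => if i.val + j.val + 1 = 3 then (1 : L) else 0) γ₀ γ)
    (hKγ : ∀ᶠ v in cofinite, ∀ g : (UnitaryGroup.cmDatum L 3 (Matrix.of fun i j : Fin 3 => if i.val + j.val + 1 = 3 then (1 : L) else 0)).Local v,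
      g ∈ UnitaryGroup.cmLocalIntegralLevel L 3 (Matrix.of fun i j : Fin 3 => if i.val + j.val + 1 = 3 then (1 : L) else 0) v →
        IsConj (g.val : GL (Fin 3) (UnitaryGroup.LocalRing L v))
          (((UnitaryGroup.cmDatum L 3 (Matrix.of fun i j : Fin 3 => if i.val + j.val + 1 = 3 then (1 : L) else 0)).toLocal v ((UnitaryGroup.cmDatum L 3 (Matrix.of fun i j : Fin 3 => if i.val + j.val + 1 = 3 then (1 : L) else 0)).toAdelic γ)).val :
            GL (Fin 3) (UnitaryGroup.LocalRing L v)) →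
          ∃ k ∈ UnitaryGroup.cmLocalIntegralLevel L 3 (Matrix.of fun i j : Fin 3 => if i.val + j.val + 1 = 3 then (1 : L) else 0) v,
            k * (UnitaryGroup.cmDatum L 3 (Matrix.of fun i j : Fin 3 => if i.val + j.val + 1 = 3 then (1 : L) else 0)).toLocal v ((UnitaryGroup.cmDatum L 3 (Matrix.of fun i j : Fin 3 => if i.val + j.val + 1 = 3 then (1 : L) else 0)).toAdelic γ) * k⁻¹ = g) :
    ∀ᶠ v in cofinite, ∀ g : (UnitaryGroup.cmDatum L 3 (Matrix.of fun i j : Fin 3 => if i.val + j.val + 1 = 3 then (1 : L) else 0)).Local v,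
      g ∈ UnitaryGroup.cmLocalIntegralLevel L 3 (Matrix.of fun i j : Fin 3 => if i.val + j.val + 1 = 3 then (1 : L) else 0) v →
        Corresponds (UnitaryGroup.conjLocal L (IsCMField.complexConj L) v)
            ((UnitaryGroup.adelicForm L 3 H).map (UnitaryGroup.adeleToLocal L v))
            ((UnitaryGroup.adelicForm L 3 (Matrix.of fun i j : Fin 3 => if i.val + j.val + 1 = 3 then (1 : L) else 0)).map (UnitaryGroup.adeleToLocal L v))
            ((UnitaryGroup.cmDatum L 3 H).toLocal v ((UnitaryGroup.cmDatum L 3 H).toAdelic γ₀)) g →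
          ∃ k ∈ UnitaryGroup.cmLocalIntegralLevel L 3 (Matrix.of fun i j : Fin 3 => if i.val + j.val + 1 = 3 then (1 : L) else 0) v,
            k * (UnitaryGroup.cmDatum L 3 (Matrix.of fun i j : Fin 3 => if i.val + j.val + 1 = 3 then (1 : L) else 0)).toLocal v ((UnitaryGroup.cmDatum L 3 (Matrix.of fun i j : Fin 3 => if i.val + j.val + 1 = 3 then (1 : L) else 0)).toAdelic γ) * k⁻¹ = g := by
  filter_upwards [hKγ] with v hv g hg hcorr
  exact hv g hg (IsConj.symm ((corresponds_toLocal_toAdelic hγ v).isStablyConj_right hcorr))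

/-- **The `GL_3`-conjugacy form at `γ` from the clause** (converse reading, feeding ★ K6-β's `hKγ` binders).
[cite: Rogawski1990, §3.3 p. 21; §14.1 p. 232] -/
theorem MatchingAdeleG.isConj_toLocal_of_eventuallyKConj
    (hγ : Corresponds (cmConjRingHom L) H (Matrix.of fun i j : Fin 3 => if i.val + j.val + 1 = 3 then (1 : L) else 0) γ₀ γ)
    (hKCγ : ∀ᶠ v in cofinite, ∀ g : (UnitaryGroup.cmDatum L 3 (Matrix.of fun i j : Fin 3 => if i.val + j.val + 1 = 3 then (1 : L) else 0)).Local v,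
      g ∈ UnitaryGroup.cmLocalIntegralLevel L 3 (Matrix.of fun i j : Fin 3 => if i.val + j.val + 1 = 3 then (1 : L) else 0) v →
        Corresponds (UnitaryGroup.conjLocal L (IsCMField.complexConj L) v)
            ((UnitaryGroup.adelicForm L 3 H).map (UnitaryGroup.adeleToLocal L v))
            ((UnitaryGroup.adelicForm L 3 (Matrix.of fun i j : Fin 3 => if i.val + j.val + 1 = 3 then (1 : L) else 0)).map (UnitaryGroup.adeleToLocal L v))
            ((UnitaryGroup.cmDatum L 3 H).toLocal v ((UnitaryGroup.cmDatum L 3 H).toAdelic γ₀)) g →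
          ∃ k ∈ UnitaryGroup.cmLocalIntegralLevel L 3 (Matrix.of fun i j : Fin 3 => if i.val + j.val + 1 = 3 then (1 : L) else 0) v,
            k * (UnitaryGroup.cmDatum L 3 (Matrix.of fun i j : Fin 3 => if i.val + j.val + 1 = 3 then (1 : L) else 0)).toLocal v ((UnitaryGroup.cmDatum L 3 (Matrix.of fun i j : Fin 3 => if i.val + j.val + 1 = 3 then (1 : L) else 0)).toAdelic γ) * k⁻¹ = g) :
    ∀ᶠ v in cofinite, ∀ g : (UnitaryGroup.cmDatum L 3 (Matrix.of fun i j : Fin 3 => if i.val + j.val + 1 = 3 then (1 : L) else 0)).Local v,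
      g ∈ UnitaryGroup.cmLocalIntegralLevel L 3 (Matrix.of fun i j : Fin 3 => if i.val + j.val + 1 = 3 then (1 : L) else 0) v →
        IsConj (g.val : GL (Fin 3) (UnitaryGroup.LocalRing L v))
          (((UnitaryGroup.cmDatum L 3 (Matrix.of fun i j : Fin 3 => if i.val + j.val + 1 = 3 then (1 : L) else 0)).toLocal v ((UnitaryGroup.cmDatum L 3 (Matrix.of fun i j : Fin 3 => if i.val + j.val + 1 = 3 then (1 : L) else 0)).toAdelic γ)).val :
            GL (Fin 3) (UnitaryGroup.LocalRing L v)) →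
          ∃ k ∈ UnitaryGroup.cmLocalIntegralLevel L 3 (Matrix.of fun i j : Fin 3 => if i.val + j.val + 1 = 3 then (1 : L) else 0) v,
            k * (UnitaryGroup.cmDatum L 3 (Matrix.of fun i j : Fin 3 => if i.val + j.val + 1 = 3 then (1 : L) else 0)).toLocal v ((UnitaryGroup.cmDatum L 3 (Matrix.of fun i j : Fin 3 => if i.val + j.val + 1 = 3 then (1 : L) else 0)).toAdelic γ) * k⁻¹ = g := by
  filter_upwards [hKCγ] with v hv g hg hconj
  exact hv g hg ((corresponds_toLocal_toAdelic hγ v).of_isStablyConj_right (IsConj.symm hconj))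

end Clause

/-! ## §1 (E2, pair-level) the local class is the base class a.e.; a class is determined by its local and archimedean classes -/

section Dictionary

variable {L : Type} [Field L] [NumberField L] [IsCMField L] {H : Matrix (Fin 3) (Fin 3) L}
  {γ₀ : (UnitaryGroup.cmDatum L 3 H).Rational}
  {γ : (UnitaryGroup.cmDatum L 3 (Matrix.of fun i j : Fin 3 => if i.val + j.val + 1 = 3 then (1 : L) else 0)).Rational}

/-- **(ev), pair-level form** of ★ `MatchingAdeleG.eventually_map_toLocal_eq_mk`: under the clause «a.e. `v`, every element of `K_v` corresponding to
`(γ₀)_v` is `K_v`-conjugate to `γ_v`» at the ONE pair `(γ₀, γ)` (the body of ★ `MatchingAdeleGEventuallyKConj` there, no regularity asked of `γ₀`), the local class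
of any `c ∈ 𝒞_𝐀(γ₀)` is the base class `[γ_v]` for almost all `v`. [cite: Rogawski1990, §3.3 p. 21] [cite: Kottwitz1986, Prop. 7.1] -/
theorem MatchingAdeleG.eventually_map_toLocal_eq_mk_of_eventuallyKConj
    (hKCγ : ∀ᶠ v in cofinite, ∀ g : (UnitaryGroup.cmDatum L 3 (Matrix.of fun i j : Fin 3 => if i.val + j.val + 1 = 3 then (1 : L) else 0)).Local v,
      g ∈ UnitaryGroup.cmLocalIntegralLevel L 3 (Matrix.of fun i j : Fin 3 => if i.val + j.val + 1 = 3 then (1 : L) else 0) v →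
        Corresponds (UnitaryGroup.conjLocal L (IsCMField.complexConj L) v)
            ((UnitaryGroup.adelicForm L 3 H).map (UnitaryGroup.adeleToLocal L v))
            ((UnitaryGroup.adelicForm L 3 (Matrix.of fun i j : Fin 3 => if i.val + j.val + 1 = 3 then (1 : L) else 0)).map (UnitaryGroup.adeleToLocal L v))
            ((UnitaryGroup.cmDatum L 3 H).toLocal v ((UnitaryGroup.cmDatum L 3 H).toAdelic γ₀)) g →
          ∃ k ∈ UnitaryGroup.cmLocalIntegralLevel L 3 (Matrix.of fun i j : Fin 3 => if i.val + j.val + 1 = 3 then (1 : L) else 0) v,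
            k * (UnitaryGroup.cmDatum L 3 (Matrix.of fun i j : Fin 3 => if i.val + j.val + 1 = 3 then (1 : L) else 0)).toLocal v ((UnitaryGroup.cmDatum L 3 (Matrix.of fun i j : Fin 3 => if i.val + j.val + 1 = 3 then (1 : L) else 0)).toAdelic γ) * k⁻¹ = g)
    {c : ConjClasses (UnitaryGroup.cmDatum L 3 (Matrix.of fun i j : Fin 3 => if i.val + j.val + 1 = 3 then (1 : L) else 0)).Adelic}
    (hc : c ∈ MatchingAdeleG.classes L H γ₀) :
    ∀ᶠ v in cofinite, ConjClasses.map ((UnitaryGroup.cmDatum L 3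
        (Matrix.of fun i j : Fin 3 => if i.val + j.val + 1 = 3 then (1 : L) else 0)).toLocal v) c =
      ConjClasses.mk ((UnitaryGroup.cmDatum L 3 (Matrix.of fun i j : Fin 3 => if i.val + j.val + 1 = 3 then (1 : L) else 0)).toLocal v
        ((UnitaryGroup.cmDatum L 3 (Matrix.of fun i j : Fin 3 => if i.val + j.val + 1 = 3 then (1 : L) else 0)).toAdelic γ)) := by
  obtain ⟨p, rfl⟩ := hc
  filter_upwards [MatchingAdeleG.eventually_forall_exists_conj_of_eventuallyKConj hKCγ, eventually_toLocal_mem_cmLocalIntegralLevel p.adele] with v hv hint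
  obtain ⟨k, -, hk⟩ := hv p hint
  rw [conjClasses_map_mk, ConjClasses.mk_eq_mk_iff_isConj]
  exact (isConj_iff.2 ⟨k, hk⟩).symm

/-- **(inj) — the gluing, pair-level form** of ★ `MatchingAdeleG.eq_of_forall_map_toLocal_eq_of_map_archPart_eq`: two classes of `𝒞_𝐀(γ₀)` with the same local
class at every finite place and the same archimedean class are EQUAL, granted the `K_v`-conjugacy clause at the pair `(γ₀, γ)` (no regularity asked of `γ₀`).
[cite: Rogawski1990, §3.3 p. 21] [cite: Kottwitz1986, Prop. 7.1] -/
theorem MatchingAdeleG.eq_of_forall_map_toLocal_eq_of_map_archPart_eq_of_eventuallyKConj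
    (hKCγ : ∀ᶠ v in cofinite, ∀ g : (UnitaryGroup.cmDatum L 3 (Matrix.of fun i j : Fin 3 => if i.val + j.val + 1 = 3 then (1 : L) else 0)).Local v,
      g ∈ UnitaryGroup.cmLocalIntegralLevel L 3 (Matrix.of fun i j : Fin 3 => if i.val + j.val + 1 = 3 then (1 : L) else 0) v →
        Corresponds (UnitaryGroup.conjLocal L (IsCMField.complexConj L) v)
            ((UnitaryGroup.adelicForm L 3 H).map (UnitaryGroup.adeleToLocal L v))
            ((UnitaryGroup.adelicForm L 3 (Matrix.of fun i j : Fin 3 => if i.val + j.val + 1 = 3 then (1 : L) else 0)).map (UnitaryGroup.adeleToLocal L v))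
            ((UnitaryGroup.cmDatum L 3 H).toLocal v ((UnitaryGroup.cmDatum L 3 H).toAdelic γ₀)) g →
          ∃ k ∈ UnitaryGroup.cmLocalIntegralLevel L 3 (Matrix.of fun i j : Fin 3 => if i.val + j.val + 1 = 3 then (1 : L) else 0) v,
            k * (UnitaryGroup.cmDatum L 3 (Matrix.of fun i j : Fin 3 => if i.val + j.val + 1 = 3 then (1 : L) else 0)).toLocal v ((UnitaryGroup.cmDatum L 3 (Matrix.of fun i j : Fin 3 => if i.val + j.val + 1 = 3 then (1 : L) else 0)).toAdelic γ) * k⁻¹ = g)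
    {c c' : ConjClasses (UnitaryGroup.cmDatum L 3 (Matrix.of fun i j : Fin 3 => if i.val + j.val + 1 = 3 then (1 : L) else 0)).Adelic}
    (hc : c ∈ MatchingAdeleG.classes L H γ₀) (hc' : c' ∈ MatchingAdeleG.classes L H γ₀)
    (hv : ∀ v : HeightOneSpectrum (𝓞 ↥(maximalRealSubfield L)),
      ConjClasses.map ((UnitaryGroup.cmDatum L 3 (Matrix.of fun i j : Fin 3 => if i.val + j.val + 1 = 3 then (1 : L) else 0)).toLocal v) c =
        ConjClasses.map ((UnitaryGroup.cmDatum L 3 (Matrix.of fun i j : Fin 3 => if i.val + j.val + 1 = 3 then (1 : L) else 0)).toLocal v) c')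
    (ha : ConjClasses.map (UnitaryGroup.archPart (↥(maximalRealSubfield L)) L (IsCMField.complexConj L) 3
          (Matrix.of fun i j : Fin 3 => if i.val + j.val + 1 = 3 then (1 : L) else 0)) c =
        ConjClasses.map (UnitaryGroup.archPart (↥(maximalRealSubfield L)) L (IsCMField.complexConj L) 3
          (Matrix.of fun i j : Fin 3 => if i.val + j.val + 1 = 3 then (1 : L) else 0)) c') :
    c = c' := by
  obtain ⟨p, rfl⟩ := hc
  obtain ⟨p', rfl⟩ := hc'
  dsimp only at hv ha ⊢
  rw [ConjClasses.mk_eq_mk_iff_isConj]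
  have ha' : IsConj
      (UnitaryGroup.archPart (↥(maximalRealSubfield L)) L (IsCMField.complexConj L) 3
        (Matrix.of fun i j : Fin 3 => if i.val + j.val + 1 = 3 then (1 : L) else 0) p.adele)
      (UnitaryGroup.archPart (↥(maximalRealSubfield L)) L (IsCMField.complexConj L) 3
        (Matrix.of fun i j : Fin 3 => if i.val + j.val + 1 = 3 then (1 : L) else 0) p'.adele) :=
    ConjClasses.mk_eq_mk_iff_isConj.1 ha
  have hv' : ∀ v : HeightOneSpectrum (𝓞 ↥(maximalRealSubfield L)),
      IsConj ((UnitaryGroup.cmDatum L 3 (Matrix.of fun i j : Fin 3 => if i.val + j.val + 1 = 3 then (1 : L) else 0)).toLocal v p.adele)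
        ((UnitaryGroup.cmDatum L 3 (Matrix.of fun i j : Fin 3 => if i.val + j.val + 1 = 3 then (1 : L) else 0)).toLocal v p'.adele) :=
    fun v => ConjClasses.mk_eq_mk_iff_isConj.1 (hv v)
  have hK : ∀ᶠ v in cofinite, ∃ k : (UnitaryGroup.cmDatum L 3 (Matrix.of fun i j : Fin 3 => if i.val + j.val + 1 = 3 then (1 : L) else 0)).Local v,
      k ∈ UnitaryGroup.cmLocalIntegralLevel L 3 (Matrix.of fun i j : Fin 3 => if i.val + j.val + 1 = 3 then (1 : L) else 0) v ∧
        k * (UnitaryGroup.cmDatum L 3 (Matrix.of fun i j : Fin 3 => if i.val + j.val + 1 = 3 then (1 : L) else 0)).toLocal v p.adele * k⁻¹ =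
          (UnitaryGroup.cmDatum L 3 (Matrix.of fun i j : Fin 3 => if i.val + j.val + 1 = 3 then (1 : L) else 0)).toLocal v p'.adele := by
    filter_upwards [MatchingAdeleG.eventually_forall_exists_conj_of_eventuallyKConj hKCγ, eventually_toLocal_mem_cmLocalIntegralLevel p.adele,
      eventually_toLocal_mem_cmLocalIntegralLevel p'.adele] with v hKv hint hint'
    obtain ⟨k, hk, hkp⟩ := hKv p hint
    obtain ⟨k', hk', hkp'⟩ := hKv p' hint'
    refine ⟨k' * k⁻¹, mul_mem hk' (inv_mem hk), ?_⟩
    rw [← hkp, ← hkp']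
    group
  exact UnitaryGroup.isConj_of_isConj_archPart_of_forall_exists_conj (↥(maximalRealSubfield L)) L (IsCMField.complexConj L) 3
    (Matrix.of fun i j : Fin 3 => if i.val + j.val + 1 = 3 then (1 : L) else 0) ha' hv' hK

end Dictionary

/-! ## §2 (E3a, pair-level) the factored adelic stable sum -/

section Factor

variable {L : Type} [Field L] [NumberField L] [IsCMField L] {H : Matrix (Fin 3) (Fin 3) L}
  {γ₀ : (UnitaryGroup.cmDatum L 3 H).Rational}
  {γ : (UnitaryGroup.cmDatum L 3 (Matrix.of fun i j : Fin 3 => if i.val + j.val + 1 = 3 then (1 : L) else 0)).Rational}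
  [∀ g : (UnitaryGroup.cmDatum L 3 (Matrix.of fun i j : Fin 3 => if i.val + j.val + 1 = 3 then (1 : L) else 0)).Adelic,
    MeasurableSpace ((UnitaryGroup.cmDatum L 3 (Matrix.of fun i j : Fin 3 => if i.val + j.val + 1 = 3 then (1 : L) else 0)).Adelic ⧸
      Subgroup.centralizer ({g} : Set (UnitaryGroup.cmDatum L 3 (Matrix.of fun i j : Fin 3 => if i.val + j.val + 1 = 3 then (1 : L) else 0)).Adelic))]

/-- **`Σ_{𝒞_𝐀(γ₀)} Φ_m(δ, f) = (Σ_{𝒞_∞} φ_∞) · ∏_{v ∈ S} Σ_{𝒞_v} φ_v`, pair-level form** of ★ `MatchingAdeleG.adelicStableOrbitalSum_eq_finsum_mul_prod_finsum`: the same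
factorisation for ANY `γ₀` with a rational correspondent `γ`, the named fact ★ `MatchingAdeleGEventuallyKConj` + `IsRegularElt γ₀` being replaced by its body at the one
pair `(γ₀, γ)` (the hypothesis `hKCγ`). [cite: Rogawski1990, §4.3 p. 44; §5.4 (5.4.3) pp. 72–73] [cite: Kottwitz1986, Prop. 7.1] -/
theorem MatchingAdeleG.adelicStableOrbitalSum_eq_finsum_mul_prod_finsum_of_eventuallyKConj
    (hγ : Corresponds (cmConjRingHom L) H (Matrix.of fun i j : Fin 3 => if i.val + j.val + 1 = 3 then (1 : L) else 0) γ₀ γ)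
    (hKCγ : ∀ᶠ v in cofinite, ∀ g : (UnitaryGroup.cmDatum L 3 (Matrix.of fun i j : Fin 3 => if i.val + j.val + 1 = 3 then (1 : L) else 0)).Local v,
      g ∈ UnitaryGroup.cmLocalIntegralLevel L 3 (Matrix.of fun i j : Fin 3 => if i.val + j.val + 1 = 3 then (1 : L) else 0) v →
        Corresponds (UnitaryGroup.conjLocal L (IsCMField.complexConj L) v)
            ((UnitaryGroup.adelicForm L 3 H).map (UnitaryGroup.adeleToLocal L v))
            ((UnitaryGroup.adelicForm L 3 (Matrix.of fun i j : Fin 3 => if i.val + j.val + 1 = 3 then (1 : L) else 0)).map (UnitaryGroup.adeleToLocal L v))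
            ((UnitaryGroup.cmDatum L 3 H).toLocal v ((UnitaryGroup.cmDatum L 3 H).toAdelic γ₀)) g →
          ∃ k ∈ UnitaryGroup.cmLocalIntegralLevel L 3 (Matrix.of fun i j : Fin 3 => if i.val + j.val + 1 = 3 then (1 : L) else 0) v,
            k * (UnitaryGroup.cmDatum L 3 (Matrix.of fun i j : Fin 3 => if i.val + j.val + 1 = 3 then (1 : L) else 0)).toLocal v ((UnitaryGroup.cmDatum L 3 (Matrix.of fun i j : Fin 3 => if i.val + j.val + 1 = 3 then (1 : L) else 0)).toAdelic γ) * k⁻¹ = g)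
    (m : OrbitalMeasureFamily (UnitaryGroup.cmDatum L 3 (Matrix.of fun i j : Fin 3 => if i.val + j.val + 1 = 3 then (1 : L) else 0)).Adelic)
    (f : (UnitaryGroup.cmDatum L 3 (Matrix.of fun i j : Fin 3 => if i.val + j.val + 1 = 3 then (1 : L) else 0)).Adelic → ℂ)
    (φ : ∀ v : HeightOneSpectrum (𝓞 ↥(maximalRealSubfield L)),
      ConjClasses ((UnitaryGroup.cmDatum L 3 (Matrix.of fun i j : Fin 3 => if i.val + j.val + 1 = 3 then (1 : L) else 0)).Local v) → ℂ)
    (φₐ : ConjClasses (UnitaryGroup.arch (↥(maximalRealSubfield L)) L (IsCMField.complexConj L) 3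
      (Matrix.of fun i j : Fin 3 => if i.val + j.val + 1 = 3 then (1 : L) else 0)) → ℂ)
    (S : Finset (HeightOneSpectrum (𝓞 ↥(maximalRealSubfield L))))
    (hfac : ∀ c ∈ MatchingAdeleG.classes L H γ₀, classOrbitalIntegral m f c =
      φₐ (ConjClasses.map (UnitaryGroup.archPart (↥(maximalRealSubfield L)) L (IsCMField.complexConj L) 3
        (Matrix.of fun i j : Fin 3 => if i.val + j.val + 1 = 3 then (1 : L) else 0)) c) *
        ∏ᶠ v, φ v (ConjClasses.map ((UnitaryGroup.cmDatum L 3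
          (Matrix.of fun i j : Fin 3 => if i.val + j.val + 1 = 3 then (1 : L) else 0)).toLocal v) c))
    (h1 : ∀ v ∉ S, φ v (ConjClasses.mk ((UnitaryGroup.cmDatum L 3
      (Matrix.of fun i j : Fin 3 => if i.val + j.val + 1 = 3 then (1 : L) else 0)).toLocal v
        ((UnitaryGroup.cmDatum L 3 (Matrix.of fun i j : Fin 3 => if i.val + j.val + 1 = 3 then (1 : L) else 0)).toAdelic γ))) = 1)
    (h0 : ∀ v ∉ S, ∀ d, Corresponds (UnitaryGroup.conjLocal L (IsCMField.complexConj L) v)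
        ((UnitaryGroup.adelicForm L 3 H).map (UnitaryGroup.adeleToLocal L v))
        ((UnitaryGroup.adelicForm L 3 (Matrix.of fun i j : Fin 3 => if i.val + j.val + 1 = 3 then (1 : L) else 0)).map (UnitaryGroup.adeleToLocal L v))
        ((UnitaryGroup.cmDatum L 3 H).toLocal v ((UnitaryGroup.cmDatum L 3 H).toAdelic γ₀)) (Quotient.out d) →
      d ≠ ConjClasses.mk ((UnitaryGroup.cmDatum L 3
        (Matrix.of fun i j : Fin 3 => if i.val + j.val + 1 = 3 then (1 : L) else 0)).toLocal v
          ((UnitaryGroup.cmDatum L 3 (Matrix.of fun i j : Fin 3 => if i.val + j.val + 1 = 3 then (1 : L) else 0)).toAdelic γ)) → φ v d = 0)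
    (hfin : ∀ v ∈ S, (support (φ v) ∩ {d | Corresponds (UnitaryGroup.conjLocal L (IsCMField.complexConj L) v)
        ((UnitaryGroup.adelicForm L 3 H).map (UnitaryGroup.adeleToLocal L v))
        ((UnitaryGroup.adelicForm L 3 (Matrix.of fun i j : Fin 3 => if i.val + j.val + 1 = 3 then (1 : L) else 0)).map (UnitaryGroup.adeleToLocal L v))
        ((UnitaryGroup.cmDatum L 3 H).toLocal v ((UnitaryGroup.cmDatum L 3 H).toAdelic γ₀)) (Quotient.out d)}).Finite)
    (hfinₐ : (support φₐ ∩ {b | Corresponds (UnitaryGroup.conjMixed (↥(maximalRealSubfield L)) L (IsCMField.complexConj L)) (UnitaryGroup.archFormOf L 3 H)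
        (UnitaryGroup.archFormOf L 3 (Matrix.of fun i j : Fin 3 => if i.val + j.val + 1 = 3 then (1 : L) else 0))
        (cmRationalToArch L 3 H γ₀) (Quotient.out b)}).Finite) :
    adelicStableOrbitalSum (MatchingAdeleG.classes L H γ₀) m f =
      (∑ᶠ b ∈ {b | Corresponds (UnitaryGroup.conjMixed (↥(maximalRealSubfield L)) L (IsCMField.complexConj L)) (UnitaryGroup.archFormOf L 3 H)
          (UnitaryGroup.archFormOf L 3 (Matrix.of fun i j : Fin 3 => if i.val + j.val + 1 = 3 then (1 : L) else 0))
          (cmRationalToArch L 3 H γ₀) (Quotient.out b)}, φₐ b) *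
        ∏ v ∈ S, ∑ᶠ d ∈ {d | Corresponds (UnitaryGroup.conjLocal L (IsCMField.complexConj L) v)
          ((UnitaryGroup.adelicForm L 3 H).map (UnitaryGroup.adeleToLocal L v))
          ((UnitaryGroup.adelicForm L 3 (Matrix.of fun i j : Fin 3 => if i.val + j.val + 1 = 3 then (1 : L) else 0)).map (UnitaryGroup.adeleToLocal L v))
          ((UnitaryGroup.cmDatum L 3 H).toLocal v ((UnitaryGroup.cmDatum L 3 H).toAdelic γ₀)) (Quotient.out d)}, φ v d := by
  rw [adelicStableOrbitalSum_def]
  refine finsum_mem_eq_finsum_mul_prod_finsum_of_factor (MatchingAdeleG.classes L H γ₀)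
    (fun c v => ConjClasses.map ((UnitaryGroup.cmDatum L 3
      (Matrix.of fun i j : Fin 3 => if i.val + j.val + 1 = 3 then (1 : L) else 0)).toLocal v) c)
    (fun c => ConjClasses.map (UnitaryGroup.archPart (↥(maximalRealSubfield L)) L (IsCMField.complexConj L) 3
      (Matrix.of fun i j : Fin 3 => if i.val + j.val + 1 = 3 then (1 : L) else 0)) c)
    (fun v => {d | Corresponds (UnitaryGroup.conjLocal L (IsCMField.complexConj L) v)
        ((UnitaryGroup.adelicForm L 3 H).map (UnitaryGroup.adeleToLocal L v))
        ((UnitaryGroup.adelicForm L 3 (Matrix.of fun i j : Fin 3 => if i.val + j.val + 1 = 3 then (1 : L) else 0)).map (UnitaryGroup.adeleToLocal L v))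
        ((UnitaryGroup.cmDatum L 3 H).toLocal v ((UnitaryGroup.cmDatum L 3 H).toAdelic γ₀)) (Quotient.out d)})
    (fun v => ConjClasses.mk ((UnitaryGroup.cmDatum L 3
      (Matrix.of fun i j : Fin 3 => if i.val + j.val + 1 = 3 then (1 : L) else 0)).toLocal v
        ((UnitaryGroup.cmDatum L 3 (Matrix.of fun i j : Fin 3 => if i.val + j.val + 1 = 3 then (1 : L) else 0)).toAdelic γ)))
    _ (classOrbitalIntegral m f) φ φₐ S (fun v => ?_) ?_ ?_ ?_ ?_ hfac h1 (fun v hv d hd hne => h0 v hv d hd hne) hfin hfinₐ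
  · -- (he) the base class lies in the local stable class
    exact (corresponds_toLocal_toAdelic hγ v).of_isStablyConj_right (isStablyConj_of_isConj (isConj_out_conjClasses_mk _))
  · -- (inj) the gluing
    intro c hc c' hc' h
    have h1' := congrArg Prod.fst h
    have h2' := congrArg Prod.snd h
    exact MatchingAdeleG.eq_of_forall_map_toLocal_eq_of_map_archPart_eq_of_eventuallyKConj hKCγ hc hc' (fun v => congrFun h1' v) h2'
  · -- (img)
    exact fun c hc => ⟨fun v => MatchingAdeleG.corresponds_out_map_toLocal hc v, MatchingAdeleG.corresponds_out_map_archPart hc⟩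
  · -- (ev) [Kt₄] 7.1
    exact fun c hc => MatchingAdeleG.eventually_map_toLocal_eq_mk_of_eventuallyKConj hKCγ hc
  · -- (surj)
    intro δ b hδ hev hb
    obtain ⟨c, hc, hcv, hcb⟩ := MatchingAdeleG.exists_mem_classes_of_forall hγ δ b hδ hev hb
    exact ⟨c, hc, funext hcv, hcb⟩

/-- **The same with the factorisation given on FINITE sets of places**, pair-level form of ★
`MatchingAdeleG.adelicStableOrbitalSum_eq_finsum_mul_prod_finsum_of_finset`. [cite: Rogawski1990, §4.3 p. 44; §5.4 (5.4.3) pp. 72–73] [cite: Kottwitz1986, Prop. 7.1] -/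
theorem MatchingAdeleG.adelicStableOrbitalSum_eq_finsum_mul_prod_finsum_of_finset_of_eventuallyKConj
    (hγ : Corresponds (cmConjRingHom L) H (Matrix.of fun i j : Fin 3 => if i.val + j.val + 1 = 3 then (1 : L) else 0) γ₀ γ)
    (hKCγ : ∀ᶠ v in cofinite, ∀ g : (UnitaryGroup.cmDatum L 3 (Matrix.of fun i j : Fin 3 => if i.val + j.val + 1 = 3 then (1 : L) else 0)).Local v,
      g ∈ UnitaryGroup.cmLocalIntegralLevel L 3 (Matrix.of fun i j : Fin 3 => if i.val + j.val + 1 = 3 then (1 : L) else 0) v →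
        Corresponds (UnitaryGroup.conjLocal L (IsCMField.complexConj L) v)
            ((UnitaryGroup.adelicForm L 3 H).map (UnitaryGroup.adeleToLocal L v))
            ((UnitaryGroup.adelicForm L 3 (Matrix.of fun i j : Fin 3 => if i.val + j.val + 1 = 3 then (1 : L) else 0)).map (UnitaryGroup.adeleToLocal L v))
            ((UnitaryGroup.cmDatum L 3 H).toLocal v ((UnitaryGroup.cmDatum L 3 H).toAdelic γ₀)) g →
          ∃ k ∈ UnitaryGroup.cmLocalIntegralLevel L 3 (Matrix.of fun i j : Fin 3 => if i.val + j.val + 1 = 3 then (1 : L) else 0) v,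
            k * (UnitaryGroup.cmDatum L 3 (Matrix.of fun i j : Fin 3 => if i.val + j.val + 1 = 3 then (1 : L) else 0)).toLocal v ((UnitaryGroup.cmDatum L 3 (Matrix.of fun i j : Fin 3 => if i.val + j.val + 1 = 3 then (1 : L) else 0)).toAdelic γ) * k⁻¹ = g)
    (m : OrbitalMeasureFamily (UnitaryGroup.cmDatum L 3 (Matrix.of fun i j : Fin 3 => if i.val + j.val + 1 = 3 then (1 : L) else 0)).Adelic)
    (f : (UnitaryGroup.cmDatum L 3 (Matrix.of fun i j : Fin 3 => if i.val + j.val + 1 = 3 then (1 : L) else 0)).Adelic → ℂ)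
    (φ : ∀ v : HeightOneSpectrum (𝓞 ↥(maximalRealSubfield L)),
      ConjClasses ((UnitaryGroup.cmDatum L 3 (Matrix.of fun i j : Fin 3 => if i.val + j.val + 1 = 3 then (1 : L) else 0)).Local v) → ℂ)
    (φₐ : ConjClasses (UnitaryGroup.arch (↥(maximalRealSubfield L)) L (IsCMField.complexConj L) 3
      (Matrix.of fun i j : Fin 3 => if i.val + j.val + 1 = 3 then (1 : L) else 0)) → ℂ)
    (S : Finset (HeightOneSpectrum (𝓞 ↥(maximalRealSubfield L))))
    (hfac : ∀ c ∈ MatchingAdeleG.classes L H γ₀, ∃ S₂ : Finset (HeightOneSpectrum (𝓞 ↥(maximalRealSubfield L))),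
      (∀ v ∉ S₂, φ v (ConjClasses.mk ((UnitaryGroup.cmDatum L 3
        (Matrix.of fun i j : Fin 3 => if i.val + j.val + 1 = 3 then (1 : L) else 0)).toLocal v (Quotient.out c))) = 1) ∧
      classOrbitalIntegral m f c =
        φₐ (ConjClasses.mk (UnitaryGroup.archPart (↥(maximalRealSubfield L)) L (IsCMField.complexConj L) 3
          (Matrix.of fun i j : Fin 3 => if i.val + j.val + 1 = 3 then (1 : L) else 0) (Quotient.out c))) *
        ∏ v ∈ S₂, φ v (ConjClasses.mk ((UnitaryGroup.cmDatum L 3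
          (Matrix.of fun i j : Fin 3 => if i.val + j.val + 1 = 3 then (1 : L) else 0)).toLocal v (Quotient.out c))))
    (h1 : ∀ v ∉ S, φ v (ConjClasses.mk ((UnitaryGroup.cmDatum L 3
      (Matrix.of fun i j : Fin 3 => if i.val + j.val + 1 = 3 then (1 : L) else 0)).toLocal v
        ((UnitaryGroup.cmDatum L 3 (Matrix.of fun i j : Fin 3 => if i.val + j.val + 1 = 3 then (1 : L) else 0)).toAdelic γ))) = 1)
    (h0 : ∀ v ∉ S, ∀ d, Corresponds (UnitaryGroup.conjLocal L (IsCMField.complexConj L) v)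
        ((UnitaryGroup.adelicForm L 3 H).map (UnitaryGroup.adeleToLocal L v))
        ((UnitaryGroup.adelicForm L 3 (Matrix.of fun i j : Fin 3 => if i.val + j.val + 1 = 3 then (1 : L) else 0)).map (UnitaryGroup.adeleToLocal L v))
        ((UnitaryGroup.cmDatum L 3 H).toLocal v ((UnitaryGroup.cmDatum L 3 H).toAdelic γ₀)) (Quotient.out d) →
      d ≠ ConjClasses.mk ((UnitaryGroup.cmDatum L 3
        (Matrix.of fun i j : Fin 3 => if i.val + j.val + 1 = 3 then (1 : L) else 0)).toLocal v
          ((UnitaryGroup.cmDatum L 3 (Matrix.of fun i j : Fin 3 => if i.val + j.val + 1 = 3 then (1 : L) else 0)).toAdelic γ)) → φ v d = 0)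
    (hfin : ∀ v ∈ S, (support (φ v) ∩ {d | Corresponds (UnitaryGroup.conjLocal L (IsCMField.complexConj L) v)
        ((UnitaryGroup.adelicForm L 3 H).map (UnitaryGroup.adeleToLocal L v))
        ((UnitaryGroup.adelicForm L 3 (Matrix.of fun i j : Fin 3 => if i.val + j.val + 1 = 3 then (1 : L) else 0)).map (UnitaryGroup.adeleToLocal L v))
        ((UnitaryGroup.cmDatum L 3 H).toLocal v ((UnitaryGroup.cmDatum L 3 H).toAdelic γ₀)) (Quotient.out d)}).Finite)
    (hfinₐ : (support φₐ ∩ {b | Corresponds (UnitaryGroup.conjMixed (↥(maximalRealSubfield L)) L (IsCMField.complexConj L)) (UnitaryGroup.archFormOf L 3 H)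
        (UnitaryGroup.archFormOf L 3 (Matrix.of fun i j : Fin 3 => if i.val + j.val + 1 = 3 then (1 : L) else 0))
        (cmRationalToArch L 3 H γ₀) (Quotient.out b)}).Finite) :
    adelicStableOrbitalSum (MatchingAdeleG.classes L H γ₀) m f =
      (∑ᶠ b ∈ {b | Corresponds (UnitaryGroup.conjMixed (↥(maximalRealSubfield L)) L (IsCMField.complexConj L)) (UnitaryGroup.archFormOf L 3 H)
          (UnitaryGroup.archFormOf L 3 (Matrix.of fun i j : Fin 3 => if i.val + j.val + 1 = 3 then (1 : L) else 0))
          (cmRationalToArch L 3 H γ₀) (Quotient.out b)}, φₐ b) *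
        ∏ v ∈ S, ∑ᶠ d ∈ {d | Corresponds (UnitaryGroup.conjLocal L (IsCMField.complexConj L) v)
          ((UnitaryGroup.adelicForm L 3 H).map (UnitaryGroup.adeleToLocal L v))
          ((UnitaryGroup.adelicForm L 3 (Matrix.of fun i j : Fin 3 => if i.val + j.val + 1 = 3 then (1 : L) else 0)).map (UnitaryGroup.adeleToLocal L v))
          ((UnitaryGroup.cmDatum L 3 H).toLocal v ((UnitaryGroup.cmDatum L 3 H).toAdelic γ₀)) (Quotient.out d)}, φ v d := by
  refine MatchingAdeleG.adelicStableOrbitalSum_eq_finsum_mul_prod_finsum_of_eventuallyKConj hγ hKCγ m f φ φₐ S (fun c hc => ?_) h1 h0 hfin hfinₐ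
  obtain ⟨S₂, hS₂, hc'⟩ := hfac c hc
  rw [hc', conjClasses_map_eq_mk_out]
  congr 1
  simp_rw [conjClasses_map_eq_mk_out]
  refine (finprod_eq_prod_of_mulSupport_subset _ fun v hv => ?_).symm
  rw [Finset.mem_coe]
  by_contra hvS
  exact hv (hS₂ v hvS)

end Factor

end Literature.NumberTheory.Rogawski1990

end
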